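import Mathlib
import Summits.ValiantsHypothesis.ValiantsHypothesis.Theorems.RigidityForcesSymmetryRankRigidMinimalReprLaplaceFiveSeparatedCaptureEqualPencil
import Summits.ValiantsHypothesis.ValiantsHypothesis.Theorems.RigidityForcesSymmetryRankRigidMinimalReprLaplaceFiveSeparatedCaptureProlongation
import Summits.ValiantsHypothesis.ValiantsHypothesis.Theorems.RigidityForcesSymmetryRankRigidMinimalReprLaplaceFiveSeparatedCaptureSpanTools
import Summits.ValiantsHypothesis.ValiantsHypothesis.Theorems.RigidityForcesSymmetryRankRigidMinimalReprLaplaceFiveSeparatedCaptureLineInTwoPlanes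

/-!
# ValiantsHypothesis / RigidityForcesSymmetry — crux `LaplaceOptimalFive` (stmt-ValiantsHypothesis-24813), symmetric capture (SC):
# TOOLS FOR THE LAST SUB-CASE OF THE PROFILE `(1,1,3)` — EqualPencil bookkeeping for `(ℂu, ℂu, V)` and
# ★ «a zero-diagonal symmetric space of finrank ≤ 3 has a prolongation of finrank ≤ 3»

* `exists_three_off_pair` — the three letters off a pair (by `decide`).
* `finrank_le_prolong_add_one_of_diag` — `u` with a non-zero diagonal entry: ✓ `finrank_le_of_equalPencil` with the kernel LINE
  gives `finrank W ≤ finrank (prolong (V ⊔ ℂu)) + 1` (the construction inside ✓ `finrank_le_of_equalPencil_of_mem`, for `V` of any finrank).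
* `finrank_le_prolong_add_card_of_zeroDiag` — `u` zero-diagonal with non-zero rows at every letter outside `S`: the kernel vectors are
  supported on `S`, `finrank W ≤ finrank (prolong (V ⊔ ℂu)) + |S|`.
* ★ `finrank_prolong_le_three_of_zeroDiag` — if every matrix of `V` (`finrank V ≤ 3`) has zero diagonal then `finrank (prolong V) ≤ 3`:
  a non-zero member `g` of the prolongation is square-free, its slices at an injective support entry `(i,j,k)`
  (✓ `exists_inj_of_sqfree_ne_zero`) are independent and span `V`, coefficients of members of `V` are read off at the entries
  `(j,k), (i,k), (i,j)`, and the slice map at the letter `i` is injective on `prolong V`.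
Consumed by `…SeparatedCaptureEqualLinesMem` (the assembly of `(1,1,3)`).

Honest framing.  Lemmas for sub-cases of an OPEN inequality: `CaptureIneqSym` in general, K1 on `K₃ ⊔ K₂`, S2′, `LaplaceOptimalFive`
(stmt-24813, OPEN · CONTESTED 72/120), `RankRigidMinimalRepr`, `VP ≠ VNP` are NOT proved.  No definitions, no `sorry`; Mathlib + tree only.
-/

set_option linter.dupNamespace false
set_option autoImplicit false

namespace Summit.ValiantsHypothesis.ValiantsHypothesis.Theorems.RigidityForcesSymmetryRankRigidMinimalRepr

namespace LaplaceFiveSeparatedCapture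

open Finset

/-! ### Letters -/

/-- The three letters off a pair. [folklore] -/
theorem exists_three_off_pair (a b : Fin 5) (hab : a ≠ b) :
    ∃ c₁ c₂ c₃ : Fin 5, (∀ x : Fin 5, x = a ∨ x = b ∨ x = c₁ ∨ x = c₂ ∨ x = c₃) ∧
      (c₁ ≠ a ∧ c₁ ≠ b) ∧ (c₂ ≠ a ∧ c₂ ≠ b) ∧ (c₃ ≠ a ∧ c₃ ≠ b) ∧ c₁ ≠ c₂ ∧ c₁ ≠ c₃ ∧ c₂ ≠ c₃ := by
  revert hab
  fin_cases a <;> fin_cases b <;> decide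

/-! ### EqualPencil bookkeeping for `(ℂu, ℂu, V)` -/

/-- `u` with a non-zero DIAGONAL entry: the kernel vectors lie on a line, so `finrank W ≤ finrank (prolong (V ⊔ ℂu)) + 1`. [folklore] -/
theorem finrank_le_prolong_add_one_of_diag (u : Fin 5 → Fin 5 → ℂ) (hu : ∀ p q, u p q = u q p)
    (V W : Submodule ℂ (Fin 5 → Fin 5 → ℂ)) (hV : ∀ x ∈ V, ∀ p q : Fin 5, x p q = x q p)
    (hWs : ∀ μ ∈ W, ∀ s t : Fin 5, μ s t = μ t s) (hWd : ∀ μ ∈ W, ∀ s : Fin 5, μ s s = 0)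
    (hWc : ∀ μ ∈ W, contractZ μ ∈ L3 (ℂ ∙ u) (ℂ ∙ u) V) (p₀ : Fin 5) (hp₀ : u p₀ p₀ ≠ 0) :
    Module.finrank ℂ W ≤ Module.finrank ℂ (prolong (V ⊔ (ℂ ∙ u))) + 1 := by
  classical
  have hP : ∀ G : Fin 5 → Fin 5 → Fin 5 → ℂ, (∀ p q r, G p q r = G q p r) → (∀ p q r, G p q r = G p r q) →
      (∀ p, G p ∈ V ⊔ (ℂ ∙ u)) → G ∈ prolong (V ⊔ (ℂ ∙ u)) := fun G hG1 hG2 hG3 =>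
    (mem_prolong_iff _ G).mpr ⟨hG1, hG2, hG3⟩
  let d : Fin 5 → ℂ := fun r => -(2 * u p₀ r) / u p₀ p₀
  have h := finrank_le_of_equalPencil u hu V W hV hWs hWd hWc (prolong (V ⊔ (ℂ ∙ u))) hP (ℂ ∙ d) (fun a ha _ => by
    refine Submodule.mem_span_singleton.mpr ⟨a p₀, funext fun r => ?_⟩
    simp only [Pi.smul_apply, smul_eq_mul, d]
    have := ha p₀ r
    field_simp
    linear_combination -this)
  have h1 : Module.finrank ℂ (ℂ ∙ d) ≤ 1 := by
    have := finrank_span_le_card (R := ℂ) ({d} : Set (Fin 5 → ℂ))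
    simpa using this
  omega

/-- `u` ZERO-DIAGONAL with non-zero rows at every letter outside `S`: the kernel vectors are supported on `S`, so
`finrank W ≤ finrank (prolong (V ⊔ ℂu)) + |S|`. [folklore] -/
theorem finrank_le_prolong_add_card_of_zeroDiag (u : Fin 5 → Fin 5 → ℂ) (hu : ∀ p q, u p q = u q p)
    (V W : Submodule ℂ (Fin 5 → Fin 5 → ℂ)) (hV : ∀ x ∈ V, ∀ p q : Fin 5, x p q = x q p)
    (hWs : ∀ μ ∈ W, ∀ s t : Fin 5, μ s t = μ t s) (hWd : ∀ μ ∈ W, ∀ s : Fin 5, μ s s = 0)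
    (hWc : ∀ μ ∈ W, contractZ μ ∈ L3 (ℂ ∙ u) (ℂ ∙ u) V) (hdiag : ∀ p, u p p = 0)
    (S : Finset (Fin 5)) (hS : ∀ p, p ∉ S → ∃ r, u p r ≠ 0) :
    Module.finrank ℂ W ≤ Module.finrank ℂ (prolong (V ⊔ (ℂ ∙ u))) + S.card := by
  classical
  have hP : ∀ G : Fin 5 → Fin 5 → Fin 5 → ℂ, (∀ p q r, G p q r = G q p r) → (∀ p q r, G p q r = G p r q) →
      (∀ p, G p ∈ V ⊔ (ℂ ∙ u)) → G ∈ prolong (V ⊔ (ℂ ∙ u)) := fun G hG1 hG2 hG3 =>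
    (mem_prolong_iff _ G).mpr ⟨hG1, hG2, hG3⟩
  have h := finrank_le_of_equalPencil u hu V W hV hWs hWd hWc (prolong (V ⊔ (ℂ ∙ u))) hP
    (Submodule.span ℂ (↑(S.image fun k : Fin 5 => fun j : Fin 5 => if k = j then (1 : ℂ) else 0) : Set (Fin 5 → ℂ)))
    (fun a ha _ => by
      have hz : ∀ m r, u m r ≠ 0 → a m = 0 := by
        intro m r hmr
        have h := ha m r
        rw [hdiag m, zero_mul, zero_add] at h
        rcases mul_eq_zero.mp h with h' | h'
        · norm_num at h'
        · rcases mul_eq_zero.mp h' with h'' | h''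
          · exact absurd h'' hmr
          · exact h''
      refine mem_span_indicators a S fun k hk => ?_
      obtain ⟨r, hr⟩ := hS k hk
      exact hz k r hr)
  have h1 := finrank_span_indicators_le S
  omega

/-! ### A zero-diagonal space of finrank ≤ 3 has a prolongation of finrank ≤ 3 -/

/-- ★ If every matrix of a symmetric space `V` with `finrank V ≤ 3` has zero diagonal, then `finrank (prolong V) ≤ 3`: a nonzero
member `g` of the prolongation is square-free, its slices at an injective support entry `(i,j,k)` span `V`, and the slice map at the
letter `i` is injective on `prolong V` (a member with vanishing `i`-slice has vanishing `j`- and `k`-slices by reading coefficients,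
hence is a square-free cubic in two letters, i.e. zero). [folklore] -/
theorem finrank_prolong_le_three_of_zeroDiag (V : Submodule ℂ (Fin 5 → Fin 5 → ℂ))
    (hVd : ∀ x ∈ V, ∀ q : Fin 5, x q q = 0)
    (h3 : Module.finrank ℂ V ≤ 3) : Module.finrank ℂ (prolong V) ≤ 3 := by
  classical
  by_cases h0 : prolong V = ⊥
  · rw [h0, finrank_bot]; exact Nat.zero_le _
  obtain ⟨g, hgP, hne⟩ := (Submodule.ne_bot_iff _).mp h0
  obtain ⟨g12, g23, gsl⟩ := (mem_prolong_iff V g).mp hgP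
  -- members of `prolong V` are square-free
  have sqf : ∀ G ∈ prolong V, ∀ p r, G p p r = 0 := by
    intro G hG p r
    obtain ⟨G12, G23, Gsl⟩ := (mem_prolong_iff V G).mp hG
    rw [G23 p p r, G12 p r p]
    exact hVd _ (Gsl r) p
  have gsq := sqf g hgP
  obtain ⟨i, j, k, hij, hik, hjk, hijk⟩ := exists_inj_of_sqfree_ne_zero g g12 g23 gsq hne
  -- entries of the three slices
  have gi_jk : g i j k ≠ 0 := hijk
  have gj_ik : g j i k = g i j k := (g12 i j k).symm
  have gk_ij : g k i j = g i j k := by rw [g12 k i j, g23 i k j]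
  have z1 : g j j k = 0 := gsq j k
  have z2 : g k j k = 0 := by rw [g23 k j k]; exact gsq k j
  have z3 : g i i k = 0 := gsq i k
  have z4 : g k i k = 0 := by rw [g23 k i k]; exact gsq k i
  have z5 : g i i j = 0 := gsq i j
  have z6 : g j i j = 0 := by rw [g23 j i j]; exact gsq j i
  -- the three slices are independent and span `V`
  have hli : LinearIndependent ℂ ![g i, g j, g k] := by
    rw [Fintype.linearIndependent_iff]
    intro c hc
    have e := fun p q => congrFun (congrFun hc p) q
    simp only [Fin.sum_univ_three, Matrix.cons_val_zero, Matrix.cons_val_one, Matrix.cons_val_two,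
      Matrix.tail_cons, Matrix.head_cons, Pi.add_apply, Pi.smul_apply, smul_eq_mul, Pi.zero_apply] at e
    have e1 := e j k
    have e2 := e i k
    have e3 := e i j
    rw [z1, z2] at e1
    rw [gj_ik, z3, z4] at e2
    rw [z5, z6, gk_ij] at e3
    have c0 : c 0 = 0 := by
      have : c 0 * g i j k = 0 := by linear_combination e1
      exact (mul_eq_zero.mp this).resolve_right gi_jk
    have c1 : c 1 = 0 := by
      have : c 1 * g i j k = 0 := by linear_combination e2
      exact (mul_eq_zero.mp this).resolve_right gi_jk
    have c2 : c 2 = 0 := by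
      have : c 2 * g i j k = 0 := by linear_combination e3
      exact (mul_eq_zero.mp this).resolve_right gi_jk
    intro l
    fin_cases l
    · exact c0
    · exact c1
    · exact c2
  have hspan_le : Submodule.span ℂ (Set.range ![g i, g j, g k]) ≤ V := by
    refine Submodule.span_le.mpr ?_
    rintro _ ⟨l, rfl⟩
    fin_cases l
    · exact gsl i
    · exact gsl j
    · exact gsl k
  have hspan_eq : Submodule.span ℂ (Set.range ![g i, g j, g k]) = V := by
    refine Submodule.eq_of_le_of_finrank_le hspan_le ?_
    rw [finrank_span_eq_card hli]
    simpa using h3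
  -- reading coefficients: a member of `V` is determined by its entries `(j,k)`, `(i,k)`, `(i,j)`
  have readoff : ∀ x ∈ V, x j k = 0 → x i k = 0 → x i j = 0 → x = 0 := by
    intro x hx h1 h2 h3'
    have hx' : x ∈ Submodule.span ℂ (Set.range ![g i, g j, g k]) := by rw [hspan_eq]; exact hx
    obtain ⟨c, hc⟩ := Submodule.mem_span_range_iff_exists_fun ℂ |>.mp hx'
    have e := fun p q => congrFun (congrFun hc p) q
    simp only [Fin.sum_univ_three, Matrix.cons_val_zero, Matrix.cons_val_one, Matrix.cons_val_two,
      Matrix.tail_cons, Matrix.head_cons, Pi.add_apply, Pi.smul_apply, smul_eq_mul] at e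
    have e1 := e j k
    have e2 := e i k
    have e3 := e i j
    rw [h1, z1, z2] at e1
    rw [h2, gj_ik, z3, z4] at e2
    rw [h3', z5, z6, gk_ij] at e3
    have c0 : c 0 = 0 := by
      have : c 0 * g i j k = 0 := by linear_combination e1
      exact (mul_eq_zero.mp this).resolve_right gi_jk
    have c1 : c 1 = 0 := by
      have : c 1 * g i j k = 0 := by linear_combination e2
      exact (mul_eq_zero.mp this).resolve_right gi_jk
    have c2 : c 2 = 0 := by
      have : c 2 * g i j k = 0 := by linear_combination e3
      exact (mul_eq_zero.mp this).resolve_right gi_jk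
    rw [← hc]
    funext p q
    simp [Fin.sum_univ_three, c0, c1, c2]
  -- the slice map at `i` is injective on `prolong V`
  let σ : (prolong V) →ₗ[ℂ] (Fin 5 → Fin 5 → ℂ) :=
    { toFun := fun G => (G.1 : Fin 5 → Fin 5 → Fin 5 → ℂ) i, map_add' := fun _ _ => rfl, map_smul' := fun _ _ => rfl }
  have hσ : Function.Injective σ := by
    rw [injective_iff_map_eq_zero]
    intro G hG
    have hGi : ∀ q r, (G.1 : Fin 5 → Fin 5 → Fin 5 → ℂ) i q r = 0 := fun q r => congrFun (congrFun hG q) r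
    obtain ⟨G12, G23, Gsl⟩ := (mem_prolong_iff V G.1).mp G.2
    have Gsq := sqf G.1 G.2
    set H : Fin 5 → Fin 5 → Fin 5 → ℂ := G.1 with hH
    -- any entry with a letter `i` vanishes
    have hi1 : ∀ q r, H i q r = 0 := hGi
    have hi2 : ∀ p r, H p i r = 0 := fun p r => by rw [G12 p i r]; exact hi1 p r
    have hi3 : ∀ p q, H p q i = 0 := fun p q => by rw [G23 p q i]; exact hi2 p q
    -- the `j`-slice vanishes
    have hj : H j = 0 := by
      refine readoff (H j) (Gsl j) ?_ ?_ ?_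
      · show H j j k = 0; exact Gsq j k
      · show H j i k = 0; exact hi2 j k
      · show H j i j = 0; exact hi2 j j
    -- the `k`-slice vanishes
    have hk : H k = 0 := by
      refine readoff (H k) (Gsl k) ?_ ?_ ?_
      · show H k j k = 0; rw [G23 k j k, G12 k k j]; exact Gsq k j
      · show H k i k = 0; exact hi2 k k
      · show H k i j = 0; exact hi2 k j
    have hj1 : ∀ q r, H j q r = 0 := fun q r => by rw [hj]; rfl
    have hk1 : ∀ q r, H k q r = 0 := fun q r => by rw [hk]; rfl
    -- a letter outside `{i,j,k}` twice among three distinct ones: every entry vanishes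
    have key : ∀ p q r, H p q r = 0 := by
      intro p q r
      by_cases hp : p = i ∨ p = j ∨ p = k
      · rcases hp with rfl | rfl | rfl
        · exact hi1 q r
        · exact hj1 q r
        · exact hk1 q r
      by_cases hq : q = i ∨ q = j ∨ q = k
      · rw [G12 p q r]
        rcases hq with rfl | rfl | rfl
        · exact hi1 p r
        · exact hj1 p r
        · exact hk1 p r
      by_cases hr : r = i ∨ r = j ∨ r = k
      · rw [G23 p q r, G12 p r q]
        rcases hr with rfl | rfl | rfl
        · exact hi1 p q
        · exact hj1 p q
        · exact hk1 p q
      push Not at hp hq hr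
      -- `p, q, r ∉ {i,j,k}`: two of them coincide
      by_cases hpq : p = q
      · rw [hpq]; exact Gsq q r
      by_cases hpr : p = r
      · rw [hpr, G23 r q r, G12 r r q]; exact Gsq r q
      by_cases hqr : q = r
      · rw [hqr, G12 p r r, G23 r p r, G12 r r p]; exact Gsq r p
      exfalso
      have hcard : ({i, j, k, p, q, r} : Finset (Fin 5)).card ≤ 5 := by
        simpa using Finset.card_le_univ ({i, j, k, p, q, r} : Finset (Fin 5))
      have h6 : ({i, j, k, p, q, r} : Finset (Fin 5)).card = 6 := by
        rw [Finset.card_insert_of_notMem, Finset.card_insert_of_notMem, Finset.card_insert_of_notMem,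
          Finset.card_insert_of_notMem, Finset.card_insert_of_notMem, Finset.card_singleton]
        · simpa using hqr
        · simp only [Finset.mem_insert, Finset.mem_singleton, not_or]; exact ⟨hpq, hpr⟩
        · simp only [Finset.mem_insert, Finset.mem_singleton, not_or]
          exact ⟨fun h => hp.2.2 h.symm, fun h => hq.2.2 h.symm, fun h => hr.2.2 h.symm⟩
        · simp only [Finset.mem_insert, Finset.mem_singleton, not_or]
          exact ⟨hjk, fun h => hp.2.1 h.symm, fun h => hq.2.1 h.symm, fun h => hr.2.1 h.symm⟩
        · simp only [Finset.mem_insert, Finset.mem_singleton, not_or]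
          exact ⟨hij, hik, fun h => hp.1 h.symm, fun h => hq.1 h.symm, fun h => hr.1 h.symm⟩
      omega
    apply Subtype.ext
    funext p q r
    exact key p q r
  have h := LinearMap.finrank_le_finrank_of_injective hσ
  -- the image lies in `V`
  let σ' : (prolong V) →ₗ[ℂ] V := LinearMap.codRestrict V σ (fun G => ((mem_prolong_iff V G.1).mp G.2).2.2 i)
  have hσ' : Function.Injective σ' := by
    intro G G' hGG'
    apply hσ
    have := congrArg Subtype.val hGG'
    simpa [σ'] using this
  exact (LinearMap.finrank_le_finrank_of_injective hσ').trans h3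

end LaplaceFiveSeparatedCapture

end Summit.ValiantsHypothesis.ValiantsHypothesis.Theorems.RigidityForcesSymmetryRankRigidMinimalRepr
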